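import Mathlib.Data.Nat.Log
import Literature.Barriers.ValiantsHypothesis.MonotoneGap
import HarnessLib

/-!
# Hrubeš's `ε`-sensitive monotone simulation theorem (named fact, D-0014)

P. Hrubeš, *On ε-sensitive monotone computations*, Comput. Complexity **29** (2020), Art. 6
(preprint ECCC TR19-034, read for this file as `paper:galaxy-pdf-8480837716326541740`), §2,
**Theorem 1** (proved in §4 from Lemma 22 — "to every gate `u` [of a homogeneous monotone
circuit] we can assign `R_u > 0` such that `R_u (Σ x_i)^{deg u} - û` can be simultaneously
computed by a monotone circuit of size `O(s + n log n)`" — and the "quite standard"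
one-subtraction Lemma 23, with `ε₀ := R⁻¹`):

> "Let `f ∈ ℝ[x_1, …, x_n]` be a polynomial of degree `d` which can be computed by an
> arithmetic circuit of size `s`. Then there exists `ε₀ > 0` such for every `0 < ε < ε₀`,
> `(x_1 + ⋯ + x_n + 1)^d + ε f` can be computed by a monotone arithmetic [circuit] of size
> `O(s d² + n log n)`."

Conventions of the source (§2, first paragraph): "an arithmetic circuit will always be an
arithmetic circuit over `ℝ` with binary operations addition and multiplication … The size of a
circuit is the number of its gates. A monotone arithmetic circuit is one in which all the
constants are non-negative." And the two remarks following Theorem 1 (§2): "Observe that the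
'universal polynomial' `U = (Σ_i x_i + 1)^d` itself has a small monotone circuit (of size
`O(n + log d)`)" and "if `g_ε` can be computed by a small monotone circuit for some `ε > 0`,
`f = (g_ε - U) ε⁻¹` has a small arithmetic circuit."

## Rendering in the tree's models

* General circuits: Hrubeš's binary `+/×` circuits over `ℝ` with constants at the leaves are
  fan-in-two circuits of the tree's `ArithCircuit ℝ` (weighted binary sums), and conversely a
  weighted sum gate `c • u + d • v` is three binary gates with constant leaves; sizes agree up to a
  factor `≤ 3` (see the docstring of `complexity`), which the `O(·)` absorbs. So "`f` can be
  computed by an arithmetic circuit of size `s`" is rendered through `s := complexity f`.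
* Monotone circuits: a binary `+/×` circuit over `ℝ` with NONNEGATIVE constants computing a real
  polynomial `h` is literally a plain fan-in-two circuit over the semiring `ℝ≥0` — Jerrum–Snir's
  model `Literature.Barriers.ValiantsHypothesis.IsMonotoneComputation` of `MonotoneGap.lean`
  (fan-in two, all sum coefficients `1`, constants only as operands) — computing a polynomial
  `g ∈ ℝ≥0[x]` with `map NNReal.toRealHom g = h`, and conversely. "`h` has a monotone circuit of
  size `≤ S`" is rendered `∃ g P, map toRealHom g = h ∧ IsMonotoneComputation P g ∧ P.size ≤ S`.
* `O(s d² + n log n)`: one absolute constant `K` (independent of `n, d, f`) and the bound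
  `K · (s d² + n ⌊log₂ n⌋ + 1)`. The `+ 1` is needed for a faithful reading at degenerate
  parameters where the printed expression vanishes although a gate is needed (e.g. `n = 1`,
  `f = x₁`, `s = complexity f = 0`, `d = 1`: `1 + x₁ + ε x₁` needs one gate while
  `s d² + n log n = 0`); `O`-statements in print are asymptotic and tolerate this.
* "of degree `d`" is `f.totalDegree = d` exactly as printed (the proof in §4 uses `d` only as an
  upper bound for `deg f`, but the weaker-hypothesis form `totalDegree ≤ d` is NOT what is
  printed and is left to consumers: pad with `(1 + Σ x_i)^{d - deg f}`).
* Variables are `Fin n`; `ε` ranges over `ℝ`.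

## What is here

* `Hrubes2020_sensitive` — Theorem 1 as a named fact (grounds the route item
  `Summit.ValiantsHypothesis.ValiantsHypothesis.Theses.CirculantFourier.HrubesBridge`, which is
  the same statement with `totalDegree ≤ d` and the coarser overhead `C (L(f) + n + d + 1)³`).

The two printed remarks after Theorem 1 — `U = (1 + Σ x_i)^d` has monotone circuits of size
`O(n + log d)` (repeated squaring), and a monotone circuit for `g_ε = U + ε f`, `ε > 0`, gives a
general circuit for `f = (g_ε - U) ε⁻¹` (one weighted-sum gate on top; the content of the route
item `…Theses.CirculantFourier.TargetImpliesSensitive` up to its change of variables) — are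
elementary and provable in the tree's models; they are quoted here, not vendored as facts.

Deliberately NOT here: Lemmas 22–23, the variants of §4.1 (other universal polynomials,
multilinear / bounded-depth models, Proposition 25), the Boolean part of the paper (Theorems 3,
4, 20: `ε`-sensitive nonnegative rank and separation complexity) and the proof system AMC
(Theorem 6).

## References

* [Hrubes2020] P. Hrubeš, *On ε-sensitive monotone computations*, Comput. Complexity 29 (2020)
  Art. 6; ECCC TR19-034 (2019), §2 Theorem 1 and the two remarks after it, §4 (proof,
  Lemmas 22–23, "Theorem 1 (restated)").
* [JerrumSnir1982] for the monotone model (via `MonotoneGap.lean`).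
* [Burgisser2000] Def. 2.1 for the general model (via `ArithCircuit.lean`).
-/

noncomputable section

namespace Literature.Computability.AlgebraicComplexity

open MvPolynomial
open scoped NNReal

/-- **Hrubeš 2020, Theorem 1 (`ε`-sensitive monotone simulation).** "Let `f ∈ ℝ[x_1,…,x_n]` be a
polynomial of degree `d` which can be computed by an arithmetic circuit of size `s`. Then there
exists `ε₀ > 0` such for every `0 < ε < ε₀`, `(x_1 + ⋯ + x_n + 1)^d + ε f` can be computed by a
monotone arithmetic circuit of size `O(s d² + n log n)`." Rendered (module docstring): one
absolute constant `K`; `s = complexity f` (fan-in-two circuits over `ℝ`); the monotone circuit is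
a Jerrum–Snir monotone computation over `ℝ≥0` of a polynomial `g` mapping to
`(1 + Σ x_i)^d + ε f`; size bound `K (s d² + n ⌊log₂ n⌋ + 1)`. Grounds
`Summit.ValiantsHypothesis.ValiantsHypothesis.Theses.CirculantFourier.HrubesBridge`.
[cite: Hrubes2020, Thm 1] -/
def Hrubes2020_sensitive : Prop :=
  ∃ K : ℕ, ∀ (n d : ℕ) (f : MvPolynomial (Fin n) ℝ), f.totalDegree = d →
    ∃ ε₀ : ℝ, 0 < ε₀ ∧ ∀ ε : ℝ, 0 < ε → ε < ε₀ →
      ∃ (g : MvPolynomial (Fin n) ℝ≥0) (P : ArithCircuit ℝ≥0 (Fin n)),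
        MvPolynomial.map NNReal.toRealHom g =
            (1 + ∑ i : Fin n, MvPolynomial.X i) ^ d + MvPolynomial.C ε * f ∧
          Literature.Barriers.ValiantsHypothesis.IsMonotoneComputation P g ∧
          P.size ≤ K * (complexity f * d ^ 2 + n * Nat.log 2 n + 1)

end Literature.Computability.AlgebraicComplexity

end
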